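import Literature.AlgebraicGeometry.Motives.IntegralModelRestrictScalarsSemilinear
import Literature.AlgebraicGeometry.Motives.IntegralModelRestrictScalarsPoints
import HarnessLib

/-!
# How a semilinear relabelling moves sheets and points-over-sheets

Topic `Literature/AlgebraicGeometry/Motives`; namespace `Literature.AlgebraicGeometry.Motives.IntegralModel`.  Theorems only (no `def`, no named
fact, no instance, no notation, no `sorry`); sequel of ★ `IntegralModelRestrictScalarsSemilinear` (the relabelling `semilinearHom u` of a
`g`-semilinear endomorphism `u` of a model `𝓜` over `B`, `g : B ≃ₐ[A] B`) and ★ `IntegralModelRestrictScalarsPoints` (points of the restricted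
model `restrictScalars 𝓜` over `A` are pairs (sheet, point over the sheet)).  Cell `hodgecm-mathlib`, P6 «MOD programme», GEN layer, organ
«SEMILIN-SHEETS».  HC_CM is proved only modulo the printed citations until rung 0 closes; nothing here is about HC.

## What is proved

* §1 (any pushout square `A → K`, `B → L`): the relabelling `semilinearHom 𝓜 g u` COVERS the sheet relabelling
  `semilinearHom (trivialModel B L) g (Spec g)` of the sheet model `𝓑 = Spec B` (`semilinearHom_comp_strHom`); hence the sheet of the moved point
  `y ≫ semilinearHom 𝓜 g u` is the moved sheet (`sheetOf_comp_semilinearHom`), its point over the sheet has underlying map `y.left ≫ u`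
  (`pointOverSheet_comp_semilinearHom_left`), and on an affine test scheme `Spec k` the sheet `ē : B →ₐ[A] k` becomes `ē ∘ g`
  (`sheetRingHom_comp_sheetRelabel`, `sheetRingHom_sheetOf_comp_semilinearHom`).
* §2 (number fields, `𝓞 L ⊆ B ⊆ L`, ★ `restrictScalarsOfIntermediate hinj`): the same after localising at a finite place `w` of `F`
  (`localiseMap_semilinearHomOf_comp`, `sheetAt_comp_localiseMap_semilinearHomOf`, `pointAt_comp_localiseMap_semilinearHomOf_left`), on the
  special fibre (`specialSheet_map_localiseMap_semilinearHomOf`), and — through ★ `isoMk_aut_hom_eq_localiseMap_semilinearHomOf` — for ANY action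
  `θ` of `Γ × G` on the localised restricted model with MH's generic fibre `_hθ`: `θ(γ, 1)_s` moves the special sheet by `(Spec g)_s`
  (`specialSheet_map_isoMk_aut`), i.e. the sheet `ē` of a special point goes to `ē ∘ g = ē ∘ γ⁻¹|_B` — the integral-model half of the TWIST
  fields (`smap`, `quot_smap`, `transl_act`, …) of the P6a `ModuliDatum`, which thereby become statements about ONE `B`-morphism `u_γ` of `𝓜ᵢ`.

References: [GortzWedhorn2020] §(4.8)–(4.9) (points with values in a ring, base change of points) and (14.20) (Weil restriction ∕ base
change adjunction); [SerreTate1968] §1 (models over the local ring at `w`); [EGAIV3] 11.10 (schematic density, through ★ UNIQ-θ).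
-/

set_option backward.isDefEq.respectTransparency false

open CategoryTheory CategoryTheory.Limits AlgebraicGeometry IsDedekindDomain IsDedekindDomain.HeightOneSpectrum
open scoped NumberField nonZeroDivisors
open Literature.NumberTheory.EllipticCurves (genericFibre)
open Literature.NumberTheory.DiophantineGeometry (geomResidueField specialFibreFunctor residueFieldPoints)
open Literature.AlgebraicGeometry.RelativeSpec (ActionOver)

namespace Literature.AlgebraicGeometry.Motives.IntegralModel

/-! ## §1 Generic square: the relabelling covers the sheet relabelling -/

section Semilinear

variable {A K B L : Type} [CommRing A] [Field K] [Algebra A K] [CommRing B] [Field L] [Algebra B L]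
  [Algebra A B] [Algebra K L] [Algebra A L] [IsScalarTower A B L] [IsScalarTower A K L] [Algebra.IsPushout A B K L]
  {Z : SchemeOver L} (𝓜 : IntegralModel B L Z)

omit [Algebra A K] [Algebra K L] [Algebra A L] [IsScalarTower A B L] [IsScalarTower A K L] [Algebra.IsPushout A B K L] in
/-- The sheet relabelling `Spec g` is a `g`-semilinear endomorphism of the trivial model `Spec B` of `Spec L` (the hypothesis `hu` of ★
`semilinearHom` for `trivialModel B L`). [cite: GortzWedhorn2020, §(4.8)–(4.9)] -/
theorem specMap_comp_trivialModel_total_hom (g : B ≃ₐ[A] B) :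
    Spec.map (CommRingCat.ofHom (g : B →+* B)) ≫ (trivialModel B L).total.hom =
      (trivialModel B L).total.hom ≫ Spec.map (CommRingCat.ofHom (g : B →+* B)) := by
  change Spec.map _ ≫ 𝟙 _ = 𝟙 _ ≫ Spec.map _
  rw [Category.comp_id, Category.id_comp]

/-- **The relabelling covers the sheet relabelling**: `semilinearHom 𝓜 g u ≫ str = str ≫ semilinearHom 𝓑 g (Spec g)` — this is the hypothesis
`hu : u ≫ (𝓜.total → Spec B) = (𝓜.total → Spec B) ≫ Spec g` read as an identity of morphisms of restricted models over `Spec A`.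
[cite: GortzWedhorn2020, §(4.8)–(4.9)] -/
theorem semilinearHom_comp_strHom (g : B ≃ₐ[A] B) (u : 𝓜.total.left ⟶ 𝓜.total.left)
    (hu : u ≫ 𝓜.total.hom = 𝓜.total.hom ≫ Spec.map (CommRingCat.ofHom (g : B →+* B))) :
    semilinearHom (A := A) (K := K) 𝓜 g u hu ≫ strHom (A := A) (K := K) 𝓜 =
      strHom (A := A) (K := K) 𝓜 ≫ semilinearHom (A := A) (K := K) (trivialModel B L) g (Spec.map (CommRingCat.ofHom (g : B →+* B)))
        (specMap_comp_trivialModel_total_hom (L := L) g) := by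
  ext : 1
  exact hu

/-- **The sheet of a moved point is the moved sheet**: `sheetOf (y ≫ semilinearHom 𝓜 g u) = sheetOf y ≫ semilinearHom 𝓑 g (Spec g)`.
[cite: GortzWedhorn2020, §(4.8)–(4.9)] -/
theorem sheetOf_comp_semilinearHom {T : SchemeOver A} (g : B ≃ₐ[A] B) (u : 𝓜.total.left ⟶ 𝓜.total.left)
    (hu : u ≫ 𝓜.total.hom = 𝓜.total.hom ≫ Spec.map (CommRingCat.ofHom (g : B →+* B)))
    (y : T ⟶ (restrictScalars (A := A) (K := K) 𝓜).total) :
    sheetOf 𝓜 (y ≫ semilinearHom (A := A) (K := K) 𝓜 g u hu) =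
      sheetOf 𝓜 y ≫ semilinearHom (A := A) (K := K) (trivialModel B L) g (Spec.map (CommRingCat.ofHom (g : B →+* B)))
        (specMap_comp_trivialModel_total_hom (L := L) g) := by
  change (y ≫ _) ≫ _ = (y ≫ _) ≫ _
  rw [Category.assoc, Category.assoc, semilinearHom_comp_strHom]

/-- The underlying map of the moved sheet: `y.left ≫ (𝓜.total → Spec B) ≫ Spec g`. [cite: GortzWedhorn2020, §(4.8)–(4.9)] -/
theorem sheetOf_comp_semilinearHom_left {T : SchemeOver A} (g : B ≃ₐ[A] B) (u : 𝓜.total.left ⟶ 𝓜.total.left)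
    (hu : u ≫ 𝓜.total.hom = 𝓜.total.hom ≫ Spec.map (CommRingCat.ofHom (g : B →+* B)))
    (y : T ⟶ (restrictScalars (A := A) (K := K) 𝓜).total) :
    (sheetOf 𝓜 (y ≫ semilinearHom (A := A) (K := K) 𝓜 g u hu)).left =
      y.left ≫ 𝓜.total.hom ≫ Spec.map (CommRingCat.ofHom (g : B →+* B)) := by
  rw [sheetOf_comp_semilinearHom, Over.comp_left, sheetOf_left, semilinearHom_left, Category.assoc]

/-- **The point over the moved sheet is `u` of the point over the sheet** (underlying maps; the two live over the two sheets).
[cite: GortzWedhorn2020, §(4.8)–(4.9)] -/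
theorem pointOverSheet_comp_semilinearHom_left {T : SchemeOver A} (g : B ≃ₐ[A] B) (u : 𝓜.total.left ⟶ 𝓜.total.left)
    (hu : u ≫ 𝓜.total.hom = 𝓜.total.hom ≫ Spec.map (CommRingCat.ofHom (g : B →+* B)))
    (y : T ⟶ (restrictScalars (A := A) (K := K) 𝓜).total) :
    (pointOverSheet 𝓜 (y ≫ semilinearHom (A := A) (K := K) 𝓜 g u hu)).left = (pointOverSheet 𝓜 y).left ≫ u := rfl

/-- **Moving a point = re-pairing**: the moved point is the pair (moved sheet, `u` of the point over the sheet) — stated through ★ `ofPointOverSheet`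
on underlying maps. [cite: GortzWedhorn2020, §(4.8)–(4.9)] -/
theorem comp_semilinearHom_eq_ofPointOverSheet {T : SchemeOver A} (g : B ≃ₐ[A] B) (u : 𝓜.total.left ⟶ 𝓜.total.left)
    (hu : u ≫ 𝓜.total.hom = 𝓜.total.hom ≫ Spec.map (CommRingCat.ofHom (g : B →+* B)))
    (y : T ⟶ (restrictScalars (A := A) (K := K) 𝓜).total) :
    y ≫ semilinearHom (A := A) (K := K) 𝓜 g u hu =
      ofPointOverSheet (A := A) (K := K) 𝓜 (sheetOf 𝓜 (y ≫ semilinearHom (A := A) (K := K) 𝓜 g u hu))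
        (pointOverSheet 𝓜 (y ≫ semilinearHom (A := A) (K := K) 𝓜 g u hu)) :=
  (ofPointOverSheet_pointOverSheet 𝓜 _).symm

variable {k : Type} [CommRing k] [Algebra A k]

/-- **On `Spec k` the sheet relabelling is precomposition with `g`**: the ring map of the sheet `s ≫ semilinearHom 𝓑 g (Spec g)` is `ē ∘ g`
(`ē` the ring map of `s`; `Spec` is contravariant). [cite: GortzWedhorn2020, §(4.8)–(4.9)] -/
theorem sheetRingHom_comp_sheetRelabel (g : B ≃ₐ[A] B) (s : specOver A k ⟶ (sheetModel A K B L).total) :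
    sheetRingHom (A := A) (K := K) (B := B) (L := L)
        (s ≫ semilinearHom (A := A) (K := K) (trivialModel B L) g (Spec.map (CommRingCat.ofHom (g : B →+* B)))
          (specMap_comp_trivialModel_total_hom (L := L) g)) =
      (sheetRingHom (A := A) (K := K) (B := B) (L := L) s).comp (g : B →ₐ[A] B) := by
  have h : Spec.map (CommRingCat.ofHom (sheetRingHom (A := A) (K := K) (B := B) (L := L)
        (s ≫ semilinearHom (A := A) (K := K) (trivialModel B L) g (Spec.map (CommRingCat.ofHom (g : B →+* B)))
          (specMap_comp_trivialModel_total_hom (L := L) g))).toRingHom) =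
      Spec.map (CommRingCat.ofHom ((sheetRingHom (A := A) (K := K) (B := B) (L := L) s).toRingHom.comp (g : B →+* B))) := by
    rw [specMap_sheetRingHom, CommRingCat.ofHom_comp, Spec.map_comp, specMap_sheetRingHom]
    rfl
  have h2 := congrArg CommRingCat.Hom.hom (Spec.map_injective h)
  ext b
  exact RingHom.congr_fun h2 b

/-- **The sheet of a moved `k`-point is `ē ∘ g`.** [cite: GortzWedhorn2020, §(4.8)–(4.9)] -/
theorem sheetRingHom_sheetOf_comp_semilinearHom (g : B ≃ₐ[A] B) (u : 𝓜.total.left ⟶ 𝓜.total.left)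
    (hu : u ≫ 𝓜.total.hom = 𝓜.total.hom ≫ Spec.map (CommRingCat.ofHom (g : B →+* B)))
    (y : specOver A k ⟶ (restrictScalars (A := A) (K := K) 𝓜).total) :
    sheetRingHom (A := A) (K := K) (B := B) (L := L) (sheetOf 𝓜 (y ≫ semilinearHom (A := A) (K := K) 𝓜 g u hu)) =
      (sheetRingHom (A := A) (K := K) (B := B) (L := L) (sheetOf 𝓜 y)).comp (g : B →ₐ[A] B) := by
  rw [sheetOf_comp_semilinearHom, sheetRingHom_comp_sheetRelabel]

end Semilinear

/-! ## §2 Number fields: the same after localising at `w`, on the special fibre, and for MH's `θ(γ, 1)` -/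

section NumberField

variable {F L : Type} [Field F] [NumberField F] [Field L] [NumberField L] [Algebra F L]
  {B : Type} [CommRing B] [Algebra (𝓞 L) B] [Algebra B L] [IsScalarTower (𝓞 L) B L]
  [Algebra (𝓞 F) B] [IsScalarTower (𝓞 F) B L]
  (hinj : Function.Injective (algebraMap B L)) (w : HeightOneSpectrum (𝓞 F)) {Z : SchemeOver L}

/-- Number-field form of `semilinearHom_comp_strHom`: `semilinearHomOf 𝓜 g u ≫ strHomOf 𝓜 = strHomOf 𝓜 ≫ semilinearHomOf 𝓑 g (Spec g)`.
[cite: GortzWedhorn2020, §(4.8)–(4.9)] -/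
theorem semilinearHomOf_comp_strHomOf (𝓜 : IntegralModel B L Z) (g : B ≃ₐ[𝓞 F] B) (u : 𝓜.total.left ⟶ 𝓜.total.left)
    (hu : u ≫ 𝓜.total.hom = 𝓜.total.hom ≫ Spec.map (CommRingCat.ofHom (g : B →+* B))) :
    semilinearHomOf (F := F) hinj 𝓜 g u hu ≫ strHomOf (F := F) hinj 𝓜 =
      strHomOf (F := F) hinj 𝓜 ≫ semilinearHomOf (F := F) hinj (trivialModel B L) g (Spec.map (CommRingCat.ofHom (g : B →+* B)))
        (specMap_comp_trivialModel_total_hom (L := L) g) :=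
  haveI := isPushout_of_injective (F := F) hinj
  semilinearHom_comp_strHom (A := 𝓞 F) (K := F) 𝓜 g u hu

/-- **Localised form**: `(semilinearHomOf u ⊗ 𝒪_(w)) ≫ (str ⊗ 𝒪_(w)) = (str ⊗ 𝒪_(w)) ≫ (semilinearHomOf 𝓑 (Spec g) ⊗ 𝒪_(w))` (functoriality of ★
`localiseMap`). [cite: SerreTate1968, §1] [cite: GortzWedhorn2020, §(4.8)–(4.9)] -/
theorem localiseMap_semilinearHomOf_comp (𝓜 : IntegralModel B L Z) (g : B ≃ₐ[𝓞 F] B) (u : 𝓜.total.left ⟶ 𝓜.total.left)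
    (hu : u ≫ 𝓜.total.hom = 𝓜.total.hom ≫ Spec.map (CommRingCat.ofHom (g : B →+* B))) :
    localiseMap _ _ (semilinearHomOf (F := F) hinj 𝓜 g u hu) w ≫ localiseMap _ _ (strHomOf (F := F) hinj 𝓜) w =
      localiseMap _ _ (strHomOf (F := F) hinj 𝓜) w ≫
        localiseMap _ _ (semilinearHomOf (F := F) hinj (trivialModel B L) g (Spec.map (CommRingCat.ofHom (g : B →+* B)))
          (specMap_comp_trivialModel_total_hom (L := L) g)) w := by
  simp only [localiseMap_eq, ← Functor.map_comp, semilinearHomOf_comp_strHomOf]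

/-- **The sheet of a moved `T`-point of the localised model is the moved sheet** (`T` any `𝒪_{F,(w)}`-scheme).
[cite: SerreTate1968, §1] [cite: GortzWedhorn2020, §(4.8)–(4.9)] -/
theorem sheetAt_comp_localiseMap_semilinearHomOf (𝓜 : IntegralModel B L Z) (g : B ≃ₐ[𝓞 F] B) (u : 𝓜.total.left ⟶ 𝓜.total.left)
    (hu : u ≫ 𝓜.total.hom = 𝓜.total.hom ≫ Spec.map (CommRingCat.ofHom (g : B →+* B)))
    (T : SchemeOver (valuationSubringAtPrime F w)) (y : T ⟶ ((restrictScalarsOfIntermediate (F := F) hinj 𝓜).localise w).total) :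
    sheetAt hinj w 𝓜 T (y ≫ localiseMap _ _ (semilinearHomOf (F := F) hinj 𝓜 g u hu) w) =
      haveI := isPushout_of_injective (F := F) hinj
      sheetAt hinj w 𝓜 T y ≫ semilinearHom (A := 𝓞 F) (K := F) (trivialModel B L) g (Spec.map (CommRingCat.ofHom (g : B →+* B)))
        (specMap_comp_trivialModel_total_hom (L := L) g) := by
  haveI := isPushout_of_injective (F := F) hinj
  change sheetOf (A := 𝓞 F) (K := F) 𝓜 _ = sheetOf (A := 𝓞 F) (K := F) 𝓜 _ ≫ _
  rw [localisePointEquiv_comp_localiseMap]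
  exact sheetOf_comp_semilinearHom (A := 𝓞 F) (K := F) 𝓜 g u hu _

/-- **The point over the moved sheet is `u` of the point over the sheet**, at any level (underlying maps).
[cite: SerreTate1968, §1] [cite: GortzWedhorn2020, §(4.8)–(4.9)] -/
theorem pointAt_comp_localiseMap_semilinearHomOf_left (𝓜 : IntegralModel B L Z) (g : B ≃ₐ[𝓞 F] B)
    (u : 𝓜.total.left ⟶ 𝓜.total.left) (hu : u ≫ 𝓜.total.hom = 𝓜.total.hom ≫ Spec.map (CommRingCat.ofHom (g : B →+* B)))
    (T : SchemeOver (valuationSubringAtPrime F w)) (y : T ⟶ ((restrictScalarsOfIntermediate (F := F) hinj 𝓜).localise w).total) :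
    (pointAt hinj w 𝓜 T (y ≫ localiseMap _ _ (semilinearHomOf (F := F) hinj 𝓜 g u hu) w)).left = (pointAt hinj w 𝓜 T y).left ≫ u := by
  change (localisePointEquiv _ w T (y ≫ localiseMap _ _ (semilinearHomOf (F := F) hinj 𝓜 g u hu) w)).left =
    (localisePointEquiv _ w T y).left ≫ u
  rw [localisePointEquiv_comp_localiseMap, Over.comp_left, semilinearHomOf_left]

/-- **On the special fibre**: `(semilinearHomOf u)_s` moves the special sheet of a geometric special point by `(semilinearHomOf 𝓑 (Spec g))_s` (★
`specialSheet_map_of_comp_eq`). [cite: SerreTate1968, §1] [cite: GortzWedhorn2020, §(4.8)–(4.9)] -/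
theorem specialSheet_map_localiseMap_semilinearHomOf (𝓜 : IntegralModel B L Z) (g : B ≃ₐ[𝓞 F] B) (u : 𝓜.total.left ⟶ 𝓜.total.left)
    (hu : u ≫ 𝓜.total.hom = 𝓜.total.hom ≫ Spec.map (CommRingCat.ofHom (g : B →+* B)))
    [IsProper ((restrictScalarsOfIntermediate (F := F) hinj 𝓜).localise w).total.hom]
    [IsProper ((sheetModelOf (F := F) hinj).localise w).total.hom]
    (xbar : AlgPoints ((restrictScalarsOfIntermediate (F := F) hinj 𝓜).localise w).reductionAt (geomResidueField w)) :
    specialSheet hinj w 𝓜 (AlgPoints.map ((specialFibreFunctor w).map (localiseMap _ _ (semilinearHomOf (F := F) hinj 𝓜 g u hu) w)) xbar) =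
      AlgPoints.map ((specialFibreFunctor w).map
        (localiseMap _ _ (semilinearHomOf (F := F) hinj (trivialModel B L) g (Spec.map (CommRingCat.ofHom (g : B →+* B)))
          (specMap_comp_trivialModel_total_hom (L := L) g)) w)) (specialSheet hinj w 𝓜 xbar) :=
  specialSheet_map_of_comp_eq hinj w 𝓜 _ _ (localiseMap_semilinearHomOf_comp hinj w 𝓜 g u hu) xbar

variable (X : SchemeOver F)

/-- **MH's `θ(γ, 1)_s` moves special sheets by the sheet relabelling.**  For a model `𝓜` of `X ⊗_F L` over `B`, the Galois relabelling `u = u_γ`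
(`g = γ⁻¹|_B`, `hcompat` = its generic fibre is the sheet twist) and ANY action `θ` of `(L ≃ₐ[F] L) × G` on the localised restricted model with
MH's generic fibre `_hθ` (so `θ(γ, 1) = semilinearHomOf u ⊗ 𝒪_(w)` by ★ `isoMk_aut_hom_eq_localiseMap_semilinearHomOf`, schematic density): the
special sheet of `θ(γ, 1)_s x̄` is `(Spec g)_s` of the special sheet of `x̄` — in ring-map terms `ē ↦ ē ∘ g = ē ∘ γ⁻¹`.  This is the
integral-model half of the TWIST fields of the P6a `ModuliDatum`. [cite: EGAIV3, 11.10.5 and 11.10.1] [cite: GortzWedhorn2020, §(4.8)–(4.9) and (14.20)] -/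
theorem specialSheet_map_isoMk_aut {G : Type*} [Group G] (𝓜 : IntegralModel B L ((baseChange F L).obj X)) (γ : L ≃ₐ[F] L)
    (g : B ≃ₐ[𝓞 F] B) (hg : ∀ b : B, algebraMap B L (g b) = γ⁻¹ (algebraMap B L b))
    (u : 𝓜.total.left ⟶ 𝓜.total.left) (hu : u ≫ 𝓜.total.hom = 𝓜.total.hom ≫ Spec.map (CommRingCat.ofHom (g : B →+* B)))
    (hcompat : 𝓜.genericIso.inv.left ≫ pullback.fst 𝓜.total.hom (Spec.map (CommRingCat.ofHom (algebraMap B L))) ≫ u =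
      thickTwist X γ⁻¹ ≫ 𝓜.genericIso.inv.left ≫ pullback.fst 𝓜.total.hom (Spec.map (CommRingCat.ofHom (algebraMap B L))))
    [Flat ((restrictScalarsOfIntermediate (F := F) hinj 𝓜).localise w).total.hom]
    [IsProper ((restrictScalarsOfIntermediate (F := F) hinj 𝓜).localise w).total.hom]
    [IsProper ((sheetModelOf (F := F) hinj).localise w).total.hom]
    (θ : ActionOver ((restrictScalarsOfIntermediate (F := F) hinj 𝓜).localise w).total.hom ((L ≃ₐ[F] L) × G))
    (hθ : ∀ γ' : L ≃ₐ[F] L,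
      (genericFibre (valuationSubringAtPrime F w) F).map (Over.isoMk (θ.aut (γ', 1)) (θ.aut_comp (γ', 1))).hom ≫
          ((restrictScalarsOfIntermediate (F := F) hinj 𝓜).localise w).genericIso'.hom =
        ((restrictScalarsOfIntermediate (F := F) hinj 𝓜).localise w).genericIso'.hom ≫
          (Over.isoMk ((thickeningGalAction (L := L) X).aut γ') ((thickeningGalAction (L := L) X).aut_comp γ')).hom)
    (xbar : AlgPoints ((restrictScalarsOfIntermediate (F := F) hinj 𝓜).localise w).reductionAt (geomResidueField w)) :
    specialSheet hinj w 𝓜 (AlgPoints.map ((specialFibreFunctor w).map (Over.isoMk (θ.aut (γ, 1)) (θ.aut_comp (γ, 1))).hom) xbar) =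
      AlgPoints.map ((specialFibreFunctor w).map
        (localiseMap _ _ (semilinearHomOf (F := F) hinj (trivialModel B L) g (Spec.map (CommRingCat.ofHom (g : B →+* B)))
          (specMap_comp_trivialModel_total_hom (L := L) g)) w)) (specialSheet hinj w 𝓜 xbar) := by
  rw [isoMk_aut_hom_eq_localiseMap_semilinearHomOf hinj w X 𝓜 γ g hg u hu hcompat θ hθ]
  exact specialSheet_map_localiseMap_semilinearHomOf hinj w 𝓜 g u hu xbar

/-- **… and moves `T`-points of the localised model by re-pairing** (sheet by `Spec g`, point over the sheet by `u`): the `sheetAt` form of the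
previous theorem, valid at every level `T` (no properness needed). [cite: EGAIV3, 11.10.5 and 11.10.1] [cite: GortzWedhorn2020, §(4.8)–(4.9) and (14.20)] -/
theorem sheetAt_comp_isoMk_aut {G : Type*} [Group G] (𝓜 : IntegralModel B L ((baseChange F L).obj X)) (γ : L ≃ₐ[F] L)
    (g : B ≃ₐ[𝓞 F] B) (hg : ∀ b : B, algebraMap B L (g b) = γ⁻¹ (algebraMap B L b))
    (u : 𝓜.total.left ⟶ 𝓜.total.left) (hu : u ≫ 𝓜.total.hom = 𝓜.total.hom ≫ Spec.map (CommRingCat.ofHom (g : B →+* B)))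
    (hcompat : 𝓜.genericIso.inv.left ≫ pullback.fst 𝓜.total.hom (Spec.map (CommRingCat.ofHom (algebraMap B L))) ≫ u =
      thickTwist X γ⁻¹ ≫ 𝓜.genericIso.inv.left ≫ pullback.fst 𝓜.total.hom (Spec.map (CommRingCat.ofHom (algebraMap B L))))
    [Flat ((restrictScalarsOfIntermediate (F := F) hinj 𝓜).localise w).total.hom]
    [IsSeparated ((restrictScalarsOfIntermediate (F := F) hinj 𝓜).localise w).total.hom]
    (θ : ActionOver ((restrictScalarsOfIntermediate (F := F) hinj 𝓜).localise w).total.hom ((L ≃ₐ[F] L) × G))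
    (hθ : ∀ γ' : L ≃ₐ[F] L,
      (genericFibre (valuationSubringAtPrime F w) F).map (Over.isoMk (θ.aut (γ', 1)) (θ.aut_comp (γ', 1))).hom ≫
          ((restrictScalarsOfIntermediate (F := F) hinj 𝓜).localise w).genericIso'.hom =
        ((restrictScalarsOfIntermediate (F := F) hinj 𝓜).localise w).genericIso'.hom ≫
          (Over.isoMk ((thickeningGalAction (L := L) X).aut γ') ((thickeningGalAction (L := L) X).aut_comp γ')).hom)
    (T : SchemeOver (valuationSubringAtPrime F w)) (y : T ⟶ ((restrictScalarsOfIntermediate (F := F) hinj 𝓜).localise w).total) :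
    sheetAt hinj w 𝓜 T (y ≫ (Over.isoMk (θ.aut (γ, 1)) (θ.aut_comp (γ, 1))).hom) =
      haveI := isPushout_of_injective (F := F) hinj
      sheetAt hinj w 𝓜 T y ≫ semilinearHom (A := 𝓞 F) (K := F) (trivialModel B L) g (Spec.map (CommRingCat.ofHom (g : B →+* B)))
        (specMap_comp_trivialModel_total_hom (L := L) g) := by
  rw [isoMk_aut_hom_eq_localiseMap_semilinearHomOf hinj w X 𝓜 γ g hg u hu hcompat θ hθ]
  exact sheetAt_comp_localiseMap_semilinearHomOf hinj w 𝓜 g u hu T y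

/-- **… with the point over the sheet moved by `u`** (underlying maps). [cite: EGAIV3, 11.10.5 and 11.10.1] [cite: GortzWedhorn2020, §(4.8)–(4.9) and (14.20)] -/
theorem pointAt_comp_isoMk_aut_left {G : Type*} [Group G] (𝓜 : IntegralModel B L ((baseChange F L).obj X)) (γ : L ≃ₐ[F] L)
    (g : B ≃ₐ[𝓞 F] B) (hg : ∀ b : B, algebraMap B L (g b) = γ⁻¹ (algebraMap B L b))
    (u : 𝓜.total.left ⟶ 𝓜.total.left) (hu : u ≫ 𝓜.total.hom = 𝓜.total.hom ≫ Spec.map (CommRingCat.ofHom (g : B →+* B)))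
    (hcompat : 𝓜.genericIso.inv.left ≫ pullback.fst 𝓜.total.hom (Spec.map (CommRingCat.ofHom (algebraMap B L))) ≫ u =
      thickTwist X γ⁻¹ ≫ 𝓜.genericIso.inv.left ≫ pullback.fst 𝓜.total.hom (Spec.map (CommRingCat.ofHom (algebraMap B L))))
    [Flat ((restrictScalarsOfIntermediate (F := F) hinj 𝓜).localise w).total.hom]
    [IsSeparated ((restrictScalarsOfIntermediate (F := F) hinj 𝓜).localise w).total.hom]
    (θ : ActionOver ((restrictScalarsOfIntermediate (F := F) hinj 𝓜).localise w).total.hom ((L ≃ₐ[F] L) × G))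
    (hθ : ∀ γ' : L ≃ₐ[F] L,
      (genericFibre (valuationSubringAtPrime F w) F).map (Over.isoMk (θ.aut (γ', 1)) (θ.aut_comp (γ', 1))).hom ≫
          ((restrictScalarsOfIntermediate (F := F) hinj 𝓜).localise w).genericIso'.hom =
        ((restrictScalarsOfIntermediate (F := F) hinj 𝓜).localise w).genericIso'.hom ≫
          (Over.isoMk ((thickeningGalAction (L := L) X).aut γ') ((thickeningGalAction (L := L) X).aut_comp γ')).hom)
    (T : SchemeOver (valuationSubringAtPrime F w)) (y : T ⟶ ((restrictScalarsOfIntermediate (F := F) hinj 𝓜).localise w).total) :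
    (pointAt hinj w 𝓜 T (y ≫ (Over.isoMk (θ.aut (γ, 1)) (θ.aut_comp (γ, 1))).hom)).left = (pointAt hinj w 𝓜 T y).left ≫ u := by
  rw [isoMk_aut_hom_eq_localiseMap_semilinearHomOf hinj w X 𝓜 γ g hg u hu hcompat θ hθ]
  exact pointAt_comp_localiseMap_semilinearHomOf_left hinj w 𝓜 g u hu T y

end NumberField

end Literature.AlgebraicGeometry.Motives.IntegralModel
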